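import Summits.AtomisticToContinuum.Crystallization.Theorems.ChargedEnergyGapRotationNormal
import HarnessLib

/-!
# Charged energy gap — lens-3 g63, part P-Y: the NEAR/FAR SPLIT of the excision mass, the near half CHARGED in the kernel, and the
# FAR-RESIDUE BOUND — the one geometric statement the rotation sub-family of (H𝄪ˢ) still needs

Cell `decomp-a2c`, seat lens-3, generation 63, node «ROTATION FAMILY ⟸ FAR-RESIDUE BOUND», part P-Y (over part P-X
`…Theorems.ChargedEnergyGapRotationNormal`).  Everything below `FarResidueBound` is ELEMENTARY·PROVED (`[this work]`, no `sorry`, no new axioms).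

FRAME (critic row 1171, open point «invariant or window-summed?»).  INVARIANT, by the statement: (H𝄪ˢ) hypothesises `IsInvariantSet P X`,
`IsInvariantSet P C`, `∀ i, IsInvariantSet P (Dᵢ)` (binders 6, 7, 11), so the charging frame is P-W's periodic refolding over the motif; window
data enter only through (N𝄪ˢ)'s supercell presentations, never here.
§Y1 SPLIT — `excisionSum_split` (`E_X = E_{X ∩ S} + E_{X ∖ S}`), the tension mass into a target `tensionMassL … Y` (`excisionMassL = tensionMassL X`),
  `excisionMassL_split`.
§Y2 THE NEAR ZONE `nearZone` — points with a non-excised site of positive localised weight `χ·w` within `3ϱ/8`: by DEFINITION the filter of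
  `pricedNearCountL` (`pricedNearCountL_eq_card`), and `Λ_P`-invariant for invariant data (`isInvariantSet_nearZone`).
§Y3 REFOLDING INTO A TARGET — `tensionMassL_refold`: for invariant `Y`, `tensionMassL Y = Σ_{z ∈ F ∩ Y} receivedTension_X(z)` (P-W's proof, verbatim
  with the target decoupled from the excised set).
§Y4 ★★ NEAR CHARGING, PROVED — `tensionMassL_near_le`: `tensionMassL (X ∩ nearZone) ≤ (1024/s³)·pricedNearCountL` (each priced site receives at
  most P-V's uniform constant); ★ FAR SITES RECEIVE LITTLE — `receivedTension_far_le`: a site outside the near zone receives only from distance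
  `≥ 3ϱ/8`, at most `1024/(s³(3ϱ/8)³)` (`= 1024/46656 ≈ 0.022` at the record) — small PER SITE, but the number of far excised sites is a volume, not
  a budget currency, which is exactly why the far half is a residual and not a corollary.
§Y5 THE FAR RESIDUE `farResidue := tensionMassL (X ∖ nearZone)`; `excisionMassL = near + far`; ★★ `excisionMassL_le_near_add_far`:
  `excisionMassL ≤ (1024/s³)·pricedNearCountL + farResidue`; instances with no far excised motif site have `farResidue = 0`.
§Y6 THE RESIDUAL `FarResidueBound s lam ℓ ϱ ϱχ A_T A_χ A_H` — `farResidue ≤ A_T·shellMassL + A_χ·transMassL + A_H·pricedNearCountL` on every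
  separated labelled reference with invariant data (pure geometry of profile weights on periodic point sets and the kernel `(V′)⁺d ≤ 6d⁻⁶`);
  ★★ `excisionCharging_of_farResidueBound` (`⟹ ExcisionChargingBound … (A_H + 1024/s³)`), ★★ NODE 63 `rotationFamilyS_of_farResidueBound`:
  `FarResidueBound ∧ λτ²A_T ≤ C_T ∧ λτ²A_χ ≤ Cχ ⟹ RotationFamilyS` with `C_H := λτ²(A_H + 1024/s³)`; the record instance
  `rotationFamilyS_record_of_farResidueBound` (`A_T = 1/1350`, `A_χ = 1/45`, any `A_H ≥ 0`); ★ far-zone-empty instances CLOSED OUTRIGHT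
  (`localS_conclusion_rotField_of_farZone_empty`); record numerals (`λτ²·1024/s³ = 32/15`, `3ϱ/8 = 60`).
TAGS.  P-Y: ELEMENTARY·PROVED.  FAR-RESIDUE(1/1350, 1/45, A_H): UNDECIDED→TRUE-leaning · ATTACKABLE·M · STRICTLY WEAKER than every energetic piece
(no cocycle, no equilibrium, no stability in it) · why it might fail: a funnel geometry (thin necks of the transition layers through which many
far pairs' segments pass) where the amortised load per transition site exceeds `A_χ·w·mult²`, or shell sources with the kernel's crude tail constant
`1024/s³` in place of the true lattice sum (planar estimate: residue `1.05·10⁻³` vs transition budget `1.36` per unit area, margin `10³`; per shell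
SOURCE with the crude constant the margin fails ×30 and needs the layer-cake tail `≈ 16/s³` or the true `≈ 1.8·10⁻⁴`).
-/

noncomputable section

open scoped Classical

open Literature.MathematicalPhysics.StatisticalMechanics Literature.Geometry.DiscreteGeometry
open Summit.AtomisticToContinuum.Crystallization.Theses.PricedLinkCensus
open Summit.AtomisticToContinuum.Crystallization.Theorems.ChargedEnergyGapNegative

namespace Summit.AtomisticToContinuum.Crystallization.Theorems.ChargedEnergyGapChartDial

/-! ## §Y1 Splitting the excised set; the tension mass into a target -/

section Split

variable (P : PeriodicConfiguration 3) (X S : Set E3) (y : E3)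

/-- Splitting the excised set along any `S`: `E_X(y) = E_{X ∩ S}(y) + E_{X ∖ S}(y)`. -/
theorem excisionSum_split : excisionSum P X y = excisionSum P (X ∩ S) y + excisionSum P (X \ S) y := by
  unfold excisionSum
  rw [← (summable_excisionSummand P (X ∩ S) y).tsum_add (summable_excisionSummand P (X \ S) y)]
  refine tsum_congr fun z => ?_
  by_cases hz : (z : E3) ∈ X
  · by_cases hzS : (z : E3) ∈ S
    · have h1 : (z : E3) ∈ X ∩ S := ⟨hz, hzS⟩
      have h2 : (z : E3) ∉ X \ S := fun h => h.2 hzS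
      rw [if_pos hz, if_pos h1, if_neg h2, add_zero]
    · have h1 : (z : E3) ∉ X ∩ S := fun h => hzS h.2
      have h2 : (z : E3) ∈ X \ S := ⟨hz, hzS⟩
      rw [if_pos hz, if_neg h1, if_pos h2, zero_add]
  · have h1 : (z : E3) ∉ X ∩ S := fun h => hz h.1
    have h2 : (z : E3) ∉ X \ S := fun h => hz h.1
    rw [if_neg hz, if_neg h1, if_neg h2, add_zero]

end Split

section TensionMass

variable (ϱχ : ℝ) {m : ℕ} (D : Fin m → Set E3) (σ : Fin m → Bool) (P : PeriodicConfiguration 3) (X : Set E3) (ϱ : ℝ) (C : Set E3)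

/-- The **TENSION MASS INTO THE TARGET `Y`**: `Σ_{y ∈ F ∖ X} χ_σ(y)·w_C(y)·E_Y(y)` — the localised excision mass with the tension sums taken into
`Y` instead of `X` (`excisionMassL = tensionMassL … X`, `excisionMassL_eq_tensionMassL`). -/
def tensionMassL (Y : Set E3) : ℝ :=
  ∑ y ∈ P.motif, if y ∈ X then 0 else localFactor ϱχ D σ y * (profileWeight ϱ C y * excisionSum P Y y)

/-- `excisionMassL = tensionMassL X`. [formal bookkeeping] -/
theorem excisionMassL_eq_tensionMassL : excisionMassL ϱχ D σ P X ϱ C = tensionMassL ϱχ D σ P X ϱ C X := rfl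

/-- `tensionMassL_nonneg`. [formal bookkeeping] -/
theorem tensionMassL_nonneg (Y : Set E3) : 0 ≤ tensionMassL ϱχ D σ P X ϱ C Y :=
  Finset.sum_nonneg fun y _ => by
    split_ifs
    · exact le_rfl
    · exact mul_nonneg (localFactor_nonneg (ϱχ := ϱχ) (D := D) (σ := σ) y)
        (mul_nonneg (profileWeight_nonneg ϱ C y) (excisionSum_nonneg P Y y))

/-- ★ **SPLIT OF THE EXCISION MASS** along any set `S`: `excisionMassL = tensionMassL (X ∩ S) + tensionMassL (X ∖ S)`. -/
theorem excisionMassL_split (S : Set E3) :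
    excisionMassL ϱχ D σ P X ϱ C = tensionMassL ϱχ D σ P X ϱ C (X ∩ S) + tensionMassL ϱχ D σ P X ϱ C (X \ S) := by
  unfold excisionMassL tensionMassL
  rw [← Finset.sum_add_distrib]
  refine Finset.sum_congr rfl fun y _ => ?_
  split_ifs
  · simp
  · rw [excisionSum_split P X S y]
    ring

/-! ## §Y2 The near zone -/

/-- The **NEAR ZONE** of the instance: points having a NON-excised reference site of positive localised weight `χ_σ·w_C` within `3ϱ/8` — by
definition the filter of `pricedNearCountL` (`pricedNearCountL_eq_card`). -/
def nearZone : Set E3 :=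
  {z | ∃ y ∈ P.points, y ∉ X ∧ 0 < localFactor ϱχ D σ y * profileWeight ϱ C y ∧ dist z y < 3 * ϱ / 8}

/-- The localised near-priced excised count IS the number of excised motif sites in the near zone. -/
theorem pricedNearCountL_eq_card :
    pricedNearCountL ϱχ D σ P X ϱ C = (P.motif.filter fun z => z ∈ X ∩ nearZone ϱχ D σ P X ϱ C).card := by
  unfold pricedNearCountL
  exact congrArg Finset.card (Finset.filter_congr fun z _ => Iff.rfl)

variable {P X C D}

/-- Intersections of invariant sets are invariant. [formal bookkeeping] -/
theorem IsInvariantSet.inter_set {A B : Set E3} (hA : IsInvariantSet P A) (hB : IsInvariantSet P B) : IsInvariantSet P (A ∩ B) :=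
  fun g hg q => and_congr (hA g hg q) (hB g hg q)

/-- Differences of invariant sets are invariant. [formal bookkeeping] -/
theorem IsInvariantSet.diff_set {A B : Set E3} (hA : IsInvariantSet P A) (hB : IsInvariantSet P B) : IsInvariantSet P (A \ B) :=
  fun g hg q => and_congr (hA g hg q) (not_congr (hB g hg q))

/-- ★ The near zone of invariant data is `Λ_P`-invariant (the weights are periodic, P-W; the point set and `X` are invariant). -/
theorem isInvariantSet_nearZone (hX : IsInvariantSet P X) (hC : IsInvariantSet P C) (hD : ∀ i, IsInvariantSet P (D i)) :
    IsInvariantSet P (nearZone ϱχ D σ P X ϱ C) := by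
  intro g hg q
  constructor
  · rintro ⟨y, hy, hyX, hpos, hd⟩
    have hng : -g ∈ P.lattice := P.lattice.neg_mem hg
    refine ⟨y + -g, P.add_mem_points hy hng, fun h => hyX ((hX (-g) hng y).1 h), ?_, ?_⟩
    · rwa [localFactor_add_of_isInvariantSet ϱχ hD σ hng, profileWeight_add_of_isInvariantSet ϱ hC hng]
    · rwa [← dist_add_right q (y + -g) g, neg_add_cancel_right]
  · rintro ⟨y, hy, hyX, hpos, hd⟩
    refine ⟨y + g, P.add_mem_points hy hg, fun h => hyX ((hX g hg y).1 h), ?_, ?_⟩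
    · rwa [localFactor_add_of_isInvariantSet ϱχ hD σ hg, profileWeight_add_of_isInvariantSet ϱ hC hg]
    · rwa [dist_add_right]

/-! ## §Y3 Refolding the tension mass into an invariant target -/

/-- ★★ **THE TENSION MASS INTO AN INVARIANT TARGET, REFOLDED**: for invariant `X`, `C`, `Dᵢ` and `Y`,
`tensionMassL Y = Σ_{z ∈ F ∩ Y} receivedTension_X(z)` (P-W's `excisionMassL_refold` with the target decoupled from the excised set). -/
theorem tensionMassL_refold (hX : IsInvariantSet P X) (hC : IsInvariantSet P C) (hD : ∀ i, IsInvariantSet P (D i)) {Y : Set E3}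
    (hY : IsInvariantSet P Y) :
    tensionMassL ϱχ D σ P X ϱ C Y = ∑ z ∈ P.motif, if z ∈ Y then receivedTension ϱχ D σ P X ϱ C z else 0 := by
  set Φ : E3 → E3 → ℝ := fun y z =>
    (if y ∈ X then 0 else localFactor ϱχ D σ y * profileWeight ϱ C y) * (if z ∈ Y then max (ljD1 (dist y z)) 0 * dist y z else 0) with hΦdef
  have h0 : ∀ y z, 0 ≤ Φ y z := fun y z => by
    simp only [hΦdef]
    refine mul_nonneg ?_ ?_
    · split_ifs
      · exact le_rfl
      · exact mul_nonneg (localFactor_nonneg (ϱχ := ϱχ) (D := D) (σ := σ) y) (profileWeight_nonneg ϱ C y)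
    · split_ifs
      · exact mul_nonneg (le_max_right _ _) dist_nonneg
      · exact le_rfl
  have hΦ : ∀ g ∈ P.lattice, ∀ y z : E3, Φ (y + g) (z + g) = Φ y z := fun g hg y z => by
    simp only [hΦdef, hX g hg, hY g hg, localFactor_add_of_isInvariantSet ϱχ hD σ hg, profileWeight_add_of_isInvariantSet ϱ hC hg,
      dist_add_right]
  have hL : tensionMassL ϱχ D σ P X ϱ C Y = ∑ y ∈ P.motif, ∑' z : {z : E3 // z ∈ P.points ∧ z ≠ y}, Φ y z := by
    unfold tensionMassL excisionSum
    refine Finset.sum_congr rfl fun y _ => ?_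
    simp only [hΦdef]
    rw [tsum_mul_left]
    split_ifs <;> ring
  have hR : (∑ z ∈ P.motif, if z ∈ Y then receivedTension ϱχ D σ P X ϱ C z else 0) =
      ∑ z ∈ P.motif, ∑' y : {y : E3 // y ∈ P.points ∧ y ≠ z}, Φ y z := by
    refine Finset.sum_congr rfl fun z _ => ?_
    by_cases hz : z ∈ Y
    · rw [if_pos hz, receivedTension]
      refine tsum_congr fun y => ?_
      simp only [hΦdef, if_pos hz]
      split_ifs <;> ring
    · rw [if_neg hz]
      symm
      refine (tsum_congr fun y => ?_).trans tsum_zero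
      simp only [hΦdef, if_neg hz, mul_zero]
  have h1 : ∀ y ∈ P.motif, Summable fun z : {z : E3 // z ∈ P.points ∧ z ≠ y} => Φ y z := fun y _ => by
    simp only [hΦdef]
    exact (summable_excisionSummand P Y y).mul_left _
  have h2 : ∀ z ∈ P.motif, Summable fun y : {y : E3 // y ∈ P.points ∧ y ≠ z} => Φ y z := fun z _ => by
    by_cases hz : z ∈ Y
    · have hs := summable_receivedTension_summand ϱχ D σ P X ϱ C z
      refine (hs.congr fun y => ?_)
      simp only [hΦdef, if_pos hz]
      split_ifs <;> ring
    · refine (summable_zero.congr fun y => ?_)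
      simp only [hΦdef, if_neg hz, mul_zero]
  rw [hL, hR]
  exact sum_tsum_refold_real P Φ h0 hΦ h1 h2

/-! ## §Y4 ★★ Near charging, proved; far sites receive little -/

/-- ★★ **NEAR CHARGING**: for invariant data on an `s`-separated reference (`0 < s ≤ 1`), the tension mass received in the near zone is at most
`(1024/s³)·pricedNearCountL` — every priced excised motif site receives at most P-V's uniform constant. -/
theorem tensionMassL_near_le {s : ℝ} (hP : IsSeparatedRef s P) (hs : 0 < s) (hs1 : s ≤ 1) (hX : IsInvariantSet P X) (hC : IsInvariantSet P C)
    (hD : ∀ i, IsInvariantSet P (D i)) :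
    tensionMassL ϱχ D σ P X ϱ C (X ∩ nearZone ϱχ D σ P X ϱ C) ≤ 1024 / s ^ 3 * (pricedNearCountL ϱχ D σ P X ϱ C : ℝ) := by
  have hN := isInvariantSet_nearZone ϱχ σ ϱ hX hC hD
  rw [tensionMassL_refold ϱχ σ ϱ hX hC hD (hX.inter_set hN), pricedNearCountL_eq_card]
  -- (the two `if`s may carry different `Decidable` instances: compare termwise, then count)
  refine le_trans (Finset.sum_le_sum (g := fun z => if z ∈ X ∩ nearZone ϱχ D σ P X ϱ C then 1024 / s ^ 3 else (0 : ℝ))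
    fun z _ => ?_) (le_of_eq ?_)
  · split_ifs
    · exact (receivedTension_le_excisionSum_univ ϱχ D σ P X ϱ C z).trans (excisionSum_le_uniform P Set.univ z hP hs hs1)
    · exact le_rfl
  · rw [Finset.sum_ite, Finset.sum_const_zero, add_zero, Finset.sum_const, nsmul_eq_mul, mul_comm]

/-- ★ **FAR SITES RECEIVE LITTLE**: a site OUTSIDE the near zone receives tension only from positive-weight non-excised sites at distance
`≥ 3ϱ/8`, hence at most `1024/(s³·(3ϱ/8)³)` (P-V `excisionSum_le_farAll`; `1 ≤ 3ϱ/8`, `s ≤ 3ϱ/8`). -/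
theorem receivedTension_far_le {s : ℝ} (hP : IsSeparatedRef s P) (hs : 0 < s) (hϱ1 : 1 ≤ 3 * ϱ / 8) (hsϱ : s ≤ 3 * ϱ / 8) {z : E3}
    (hz : z ∉ nearZone ϱχ D σ P X ϱ C) : receivedTension ϱχ D σ P X ϱ C z ≤ 1024 / (s ^ 3 * (3 * ϱ / 8) ^ 3) := by
  set X' : Set E3 := {y | y ∉ X ∧ 0 < localFactor ϱχ D σ y * profileWeight ϱ C y} with hX'
  have hfar : ∀ y ∈ P.points, y ∈ X' → y ≠ z → 3 * ϱ / 8 ≤ dist z y := by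
    intro y hy hyX' _
    by_contra h
    exact hz ⟨y, hy, hyX'.1, hyX'.2, not_le.1 h⟩
  have hle : receivedTension ϱχ D σ P X ϱ C z ≤ excisionSum P X' z := by
    unfold receivedTension excisionSum
    refine Summable.tsum_le_tsum (fun y => ?_) (summable_receivedTension_summand ϱχ D σ P X ϱ C z) (summable_excisionSummand P X' z)
    rw [dist_comm (y : E3) z]
    have hT : 0 ≤ max (ljD1 (dist z (y : E3))) 0 * dist z (y : E3) := mul_nonneg (le_max_right _ _) dist_nonneg
    by_cases hyX : (y : E3) ∈ X
    · rw [if_pos hyX]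
      split_ifs
      · exact hT
      · exact le_rfl
    · rw [if_neg hyX]
      have hχ := localFactor_nonneg (ϱχ := ϱχ) (D := D) (σ := σ) (y : E3)
      have hw := profileWeight_nonneg ϱ C (y : E3)
      by_cases hpos : 0 < localFactor ϱχ D σ y * profileWeight ϱ C y
      · have hyX' : (y : E3) ∈ X' := ⟨hyX, hpos⟩
        rw [if_pos hyX']
        have h1 : localFactor ϱχ D σ y * profileWeight ϱ C y ≤ 1 := by
          calc localFactor ϱχ D σ y * profileWeight ϱ C y ≤ 1 * 1 := by
                gcongr
                · exact localFactor_le_one (ϱχ := ϱχ) (D := D) (σ := σ) (y : E3)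
                · exact profileWeight_le_one ϱ C (y : E3)
            _ = 1 := one_mul 1
        calc localFactor ϱχ D σ y * profileWeight ϱ C y * (max (ljD1 (dist z (y : E3))) 0 * dist z (y : E3))
            ≤ 1 * (max (ljD1 (dist z (y : E3))) 0 * dist z (y : E3)) := mul_le_mul_of_nonneg_right h1 hT
          _ = _ := one_mul _
      · have h0 : localFactor ϱχ D σ y * profileWeight ϱ C y = 0 := le_antisymm (not_lt.1 hpos) (mul_nonneg hχ hw)
        rw [h0, zero_mul]
        split_ifs
        · exact hT
        · exact le_rfl
  exact hle.trans (excisionSum_le_farAll P X' z hP hs hsϱ hϱ1 hfar)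

/-! ## §Y5 The far residue; the near half of the charging lemma in the kernel -/

variable (P X C D)

/-- The **FAR RESIDUE** of the instance: the tension mass received by the excised sites OUTSIDE the near zone. -/
def farResidue : ℝ :=
  tensionMassL ϱχ D σ P X ϱ C (X \ nearZone ϱχ D σ P X ϱ C)

/-- `farResidue_nonneg`. [formal bookkeeping] -/
theorem farResidue_nonneg : 0 ≤ farResidue ϱχ D σ P X ϱ C :=
  tensionMassL_nonneg ϱχ D σ P X ϱ C _

/-- `excisionMassL = near tension mass + far residue`. -/
theorem excisionMassL_eq_near_add_far :
    excisionMassL ϱχ D σ P X ϱ C = tensionMassL ϱχ D σ P X ϱ C (X ∩ nearZone ϱχ D σ P X ϱ C) + farResidue ϱχ D σ P X ϱ C :=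
  excisionMassL_split ϱχ D σ P X ϱ C _

variable {P X C D}

/-- The far residue refolded: `farResidue = Σ_{z ∈ F ∩ X ∖ nearZone} receivedTension(z)`. -/
theorem farResidue_refold (hX : IsInvariantSet P X) (hC : IsInvariantSet P C) (hD : ∀ i, IsInvariantSet P (D i)) :
    farResidue ϱχ D σ P X ϱ C =
      ∑ z ∈ P.motif, if z ∈ X \ nearZone ϱχ D σ P X ϱ C then receivedTension ϱχ D σ P X ϱ C z else 0 := by
  unfold farResidue
  rw [tensionMassL_refold ϱχ σ ϱ hX hC hD (hX.diff_set (isInvariantSet_nearZone ϱχ σ ϱ hX hC hD))]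
  exact Finset.sum_congr rfl fun z _ => by split_ifs <;> rfl

/-- PER-SITE SMALLNESS of the far residue: `≤ 1024/(s³(3ϱ/8)³)` times the number of far excised motif sites — a VOLUME term, not a budget
currency (which is why `FarResidueBound` below is a residual and not a corollary). -/
theorem farResidue_le_card {s : ℝ} (hP : IsSeparatedRef s P) (hs : 0 < s) (hϱ1 : 1 ≤ 3 * ϱ / 8) (hsϱ : s ≤ 3 * ϱ / 8)
    (hX : IsInvariantSet P X) (hC : IsInvariantSet P C) (hD : ∀ i, IsInvariantSet P (D i)) :
    farResidue ϱχ D σ P X ϱ C ≤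
      1024 / (s ^ 3 * (3 * ϱ / 8) ^ 3) * ((P.motif.filter fun z => z ∈ X \ nearZone ϱχ D σ P X ϱ C).card : ℝ) := by
  rw [farResidue_refold ϱχ σ ϱ hX hC hD]
  refine le_trans (Finset.sum_le_sum (g := fun z => if z ∈ X \ nearZone ϱχ D σ P X ϱ C then 1024 / (s ^ 3 * (3 * ϱ / 8) ^ 3) else (0 : ℝ))
    fun z _ => ?_) (le_of_eq ?_)
  · split_ifs with h
    · exact receivedTension_far_le ϱχ σ ϱ hP hs hϱ1 hsϱ h.2
    · exact le_rfl
  · rw [Finset.sum_ite, Finset.sum_const_zero, add_zero, Finset.sum_const, nsmul_eq_mul, mul_comm]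

/-- Instances with NO far excised motif site have no far residue. -/
theorem farResidue_eq_zero_of_near (hX : IsInvariantSet P X) (hC : IsInvariantSet P C) (hD : ∀ i, IsInvariantSet P (D i))
    (h : ∀ z ∈ P.motif, z ∈ X → z ∈ nearZone ϱχ D σ P X ϱ C) : farResidue ϱχ D σ P X ϱ C = 0 := by
  rw [farResidue_refold ϱχ σ ϱ hX hC hD]
  exact Finset.sum_eq_zero fun z hz => if_neg fun hzX => hzX.2 (h z hz hzX.1)

/-- ★★ **THE NEAR HALF OF THE CHARGING LEMMA, IN THE KERNEL**: for invariant data on an `s`-separated reference (`0 < s ≤ 1`),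
`excisionMassL ≤ (1024/s³)·pricedNearCountL + farResidue`. -/
theorem excisionMassL_le_near_add_far {s : ℝ} (hP : IsSeparatedRef s P) (hs : 0 < s) (hs1 : s ≤ 1) (hX : IsInvariantSet P X)
    (hC : IsInvariantSet P C) (hD : ∀ i, IsInvariantSet P (D i)) :
    excisionMassL ϱχ D σ P X ϱ C ≤ 1024 / s ^ 3 * (pricedNearCountL ϱχ D σ P X ϱ C : ℝ) + farResidue ϱχ D σ P X ϱ C := by
  rw [excisionMassL_eq_near_add_far ϱχ D σ P X ϱ C]
  have h := tensionMassL_near_le ϱχ σ ϱ hP hs hs1 hX hC hD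
  linarith

/-- ★ **FAR-ZONE-EMPTY INSTANCES ARE CLOSED OUTRIGHT**: a rotation instance of (H𝄪ˢ) all of whose excised motif sites are priced (lie in the near
zone) satisfies the (H𝄪ˢ) conclusion with `C_H := λτ²·1024/s³` and any `C_T, Cχ ≥ 0` — no residual. -/
theorem localS_conclusion_rotField_of_farZone_empty {s : ℝ} (hP : IsSeparatedRef s P) (hs : 0 < s) (hs1 : s ≤ 1)
    (hS : IsSiteStressFree P) {lamQ τ : ℝ} (hlam : 0 ≤ lamQ) (hτ : 0 ≤ τ) {r₀ v : E3} (S : Fin 0 → CutPiece)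
    (hW : SmallStrain τ P X (volterraField P S (rotField r₀ v))) (hX : IsInvariantSet P X) (hC : IsInvariantSet P C)
    (hD : ∀ i, IsInvariantSet P (D i)) (hnear : ∀ z ∈ P.motif, z ∈ X → z ∈ nearZone ϱχ D σ P X ϱ C) {C_T Cχ : ℝ} (hCT : 0 ≤ C_T)
    (hCχ : 0 ≤ Cχ) :
    -(C_T * shellMassL ϱχ D σ P X ϱ C) - Cχ * transMassL ϱχ D σ P X ϱ C -
        lamQ * τ ^ 2 * (1024 / s ^ 3) * (pricedNearCountL ϱχ D σ P X ϱ C : ℝ) ≤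
      modelFarL ϱχ D σ (volterraField P S (rotField r₀ v)) P X lamQ ϱ C := by
  refine localS_conclusion_rotField_of_geomCharging ϱχ D σ X ϱ C hS hlam hτ S hW hX ?_
  have h1 := excisionMassL_le_near_add_far ϱχ σ ϱ hP hs hs1 hX hC hD
  rw [farResidue_eq_zero_of_near ϱχ σ ϱ hX hC hD hnear, add_zero] at h1
  have hsh := shellMassL_nonneg ϱχ D σ P X ϱ C
  have htr := transMassL_nonneg ϱχ D σ P X ϱ C
  have hlt : 0 ≤ lamQ * τ ^ 2 := by positivity
  have h2 := mul_le_mul_of_nonneg_left h1 hlt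
  have h3 : 0 ≤ C_T * shellMassL ϱχ D σ P X ϱ C := mul_nonneg hCT hsh
  have h4 : 0 ≤ Cχ * transMassL ϱχ D σ P X ϱ C := mul_nonneg hCχ htr
  linarith

/-! ## §Y6 The residual FAR-RESIDUE bound and NODE 63 -/

/-- piece FAR-RESIDUE(`A_T`, `A_χ`, `A_H`) · UNDECIDED→TRUE-leaning at the record `(A_T, A_χ) = (1/1350, 1/45)`, `A_H` free · ATTACKABLE·M ·
PURELY GEOMETRIC (no cocycle, no equilibrium, no stability: profile weights on separated, labelled periodic point sets and the kernel
`(V′)⁺·d ≤ 6d⁻⁶` beyond `3ϱ/8`).  **THE FAR-RESIDUE BOUND**: on every `s`-separated `(lam, ℓ)`-labelled reference with `Λ_P`-invariant centre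
set, excised set and localisation list, the tension that the excised sites OUTSIDE the near zone receive from the positive-weight non-excised
sites (all at distance `≥ 3ϱ/8`) is at most `A_T·shellMassL + A_χ·transMassL + A_H·pricedNearCountL`.  Why it might fail: a funnel geometry
in which the segments of many far pairs cross the transition layers through few sites (amortised load above `A_χ·w·mult²` there), or shell
sources if only the crude tail constant `1024/s³` is available (per-source margin fails ×30; the layer-cake constant `≈ 16/s³` or the true lattice
tail `≈ 1.8·10⁻⁴` restores it); planar estimate: residue `≈ 1.05·10⁻³` vs transition budget `≈ 1.36` per unit area. -/
def FarResidueBound (s lam ℓ ϱ ϱχ A_T A_χ A_H : ℝ) : Prop :=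
  ∀ (P : PeriodicConfiguration 3) (C X : Set E3) (m : ℕ) (D : Fin m → Set E3) (σ : Fin m → Bool),
    IsSeparatedRef s P → IsLabelledRef lam ℓ P → IsInvariantSet P C → IsInvariantSet P X → (∀ i, IsInvariantSet P (D i)) →
    farResidue ϱχ D σ P X ϱ C ≤
      A_T * shellMassL ϱχ D σ P X ϱ C + A_χ * transMassL ϱχ D σ P X ϱ C + A_H * (pricedNearCountL ϱχ D σ P X ϱ C : ℝ)

variable {s lam ℓ μ₀ τ lamQ b₀ r_S C_T Cχ : ℝ} {ϱχ ϱ}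

/-- Larger constants give a weaker far-residue bound. [formal bookkeeping] -/
theorem FarResidueBound.mono {A_T A_χ A_H A_T' A_χ' A_H' : ℝ} (hT : A_T ≤ A_T') (hχ : A_χ ≤ A_χ') (hH : A_H ≤ A_H')
    (h : FarResidueBound s lam ℓ ϱ ϱχ A_T A_χ A_H) : FarResidueBound s lam ℓ ϱ ϱχ A_T' A_χ' A_H' := by
  intro P C X m D σ hsep hlab hC hX hD
  have h1 := h P C X m D σ hsep hlab hC hX hD
  have h2 := mul_le_mul_of_nonneg_right hT (shellMassL_nonneg ϱχ D σ P X ϱ C)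
  have h3 := mul_le_mul_of_nonneg_right hχ (transMassL_nonneg ϱχ D σ P X ϱ C)
  have h4 := mul_le_mul_of_nonneg_right hH (Nat.cast_nonneg (pricedNearCountL ϱχ D σ P X ϱ C) : (0 : ℝ) ≤ _)
  linarith

/-- ★★ **FAR RESIDUE ⟹ GEOMETRIC CHARGING**: `FarResidueBound s lam ℓ ϱ ϱχ A_T A_χ A_H` (`0 < s ≤ 1`) gives P-X's
`ExcisionChargingBound s lam ℓ ϱ ϱχ A_T A_χ (A_H + 1024/s³)` — the near half is paid in the kernel (§Y4–§Y5). -/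
theorem excisionCharging_of_farResidueBound {A_T A_χ A_H : ℝ} (hs : 0 < s) (hs1 : s ≤ 1) (h : FarResidueBound s lam ℓ ϱ ϱχ A_T A_χ A_H) :
    ExcisionChargingBound s lam ℓ ϱ ϱχ A_T A_χ (A_H + 1024 / s ^ 3) := by
  intro P C X m D σ hsep hlab hC hX hD
  have h1 := excisionMassL_le_near_add_far ϱχ σ ϱ hsep hs hs1 hX hC hD
  have h2 := h P C X m D σ hsep hlab hC hX hD
  have e : (A_H + 1024 / s ^ 3) * (pricedNearCountL ϱχ D σ P X ϱ C : ℝ) =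
      A_H * (pricedNearCountL ϱχ D σ P X ϱ C : ℝ) + 1024 / s ^ 3 * (pricedNearCountL ϱχ D σ P X ϱ C : ℝ) := by ring
  rw [e]
  linarith

/-- ★★ **NODE 63 — THE ROTATION SUB-FAMILY OF (H𝄪ˢ) FROM THE FAR-RESIDUE BOUND**: `FarResidueBound s lam ℓ ϱ ϱχ A_T A_χ A_H` with
`λτ²·A_T ≤ C_T` and `λτ²·A_χ ≤ Cχ` (`0 < s ≤ 1`, `λ, τ, A_H ≥ 0`) gives `RotationFamilyS s lam ℓ μ₀ τ λ ϱ b₀ r_S C_T ϱχ Cχ` with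
`C_H := λτ²·(A_H + 1024/s³)`. -/
theorem rotationFamilyS_of_farResidueBound {A_T A_χ A_H : ℝ} (hs : 0 < s) (hs1 : s ≤ 1) (hlam : 0 ≤ lamQ) (hτ : 0 ≤ τ) (hAH : 0 ≤ A_H)
    (h : FarResidueBound s lam ℓ ϱ ϱχ A_T A_χ A_H) (hT : lamQ * τ ^ 2 * A_T ≤ C_T) (hχ : lamQ * τ ^ 2 * A_χ ≤ Cχ) :
    RotationFamilyS s lam ℓ μ₀ τ lamQ ϱ b₀ r_S C_T ϱχ Cχ :=
  rotationFamilyS_of_excisionCharging hlam hτ (by positivity : (0 : ℝ) ≤ A_H + 1024 / s ^ 3)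
    (excisionCharging_of_farResidueBound hs hs1 h) hT hχ

/-- ★ THE RECORD INSTANCE: `FarResidueBound (3/5) (1/3) 3 160 80 (1/1350) (1/45) A_H` (any `A_H ≥ 0`) gives the rotation sub-family of the
14231 record designate (H𝄪ˢ) `(3/5, 1/3, 3, 1/100, 3/100, 1/2, 160, 2/5, 3, 1/(3·10⁶), 80, 10⁻⁵)`, with `C_H = 32/15 + 4.5·10⁻⁴·A_H`. -/
theorem rotationFamilyS_record_of_farResidueBound {A_H : ℝ} (hAH : 0 ≤ A_H)
    (h : FarResidueBound (3 / 5) (1 / 3) 3 160 80 (1 / 1350) (1 / 45) A_H) :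
    RotationFamilyS (3 / 5) (1 / 3) 3 (1 / 100) (3 / 100) (1 / 2) 160 (2 / 5) 3 (1 / 3000000) 80 (1 / 100000) :=
  rotationFamilyS_of_farResidueBound (by norm_num) (by norm_num) (by norm_num) (by norm_num) hAH h (by norm_num) (by norm_num)

/-- Record numerals of the split (`(s, τ, λ, ϱ) = (3/5, 3/100, 1/2, 160)`): the near constant `λτ²·1024/s³ = 32/15` (the kernel's share of
`C_H`), the far threshold `3ϱ/8 = 60` (`≥ 1`, `≥ s`), the far per-site constant `1024/(s³·60³) = 1024/46656 < 1/45`. -/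
theorem record_nearFar_numerals : (1 / 2 : ℝ) * (3 / 100) ^ 2 * (1024 / (3 / 5) ^ 3) = 32 / 15 ∧ (3 : ℝ) * 160 / 8 = 60 ∧
    (1 : ℝ) ≤ 3 * 160 / 8 ∧ (3 / 5 : ℝ) ≤ 3 * 160 / 8 ∧ (1024 : ℝ) / ((3 / 5) ^ 3 * (3 * 160 / 8) ^ 3) = 1024 / 46656 ∧
    (1024 : ℝ) / 46656 < 1 / 45 := by
  refine ⟨by norm_num, by norm_num, by norm_num, by norm_num, by norm_num, by norm_num⟩

end TensionMass

end Summit.AtomisticToContinuum.Crystallization.Theorems.ChargedEnergyGapChartDial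

end
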